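import Summits.BirchSwinnertonDyer.BirchSwinnertonDyer.Theorems.GenusKolyvaginAtTwoMultiGenusPrimitivityAtTwoAuxiliaryFieldOddTwist

/-!
# Route `GenusKolyvaginAtTwo`, crux stmt-BirchSwinnertonDyer-24947 `MultiGenusPrimitivityAtTwo` (U): the crux BY NAME from
# ODD-TWIST PRIMITIVITY (one rational point on one rank-one quadratic twist per instance)

Lead prover seat bsd-line-gk2-p1 (g6). `multiGenusPrimitivityAtTwo_of_oddTwistPrimitive`: the route decl
`MultiGenusPrimitivityAtTwo` (U) holds IF (`hprim`, displayed) every instance of its binders with `M₀ ≥ 1` (`2 ∣ P(1)`; the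
case `M₀ = 0` is `stub_levelOne`, PROVED, via `…OfStubs`) carries an ODD-TWIST PRIMITIVITY PACKAGE: a Kolyvagin prime `ℓ` at `2`,
a datum, radicals `θ`, an enumeration `G`, a reduced genus point `W_ℓ`, a `√d ∈ K ∖ ℚ` with a Sel₂-trivial elliptic model of the
even twist `W^{(ℓ*·d)}`, and the statement that every rational point `z₀` of the odd twist `W^{(ℓ*)}` whose transport `Φ(ι z₀)` is
an odd multiple of `W_ℓ` has no odd multiple in `2·W^{(ℓ*)}(ℚ)`. Composition of `…AuxiliaryFieldLevelOne`
(`heegner_exists_multiGenusCertificate_of_auxFieldPrimitive_levelOne`, p616107) with `…AuxiliaryFieldOddTwist`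
(`heegner_auxPrimitive_iff_oddTwistPoint`, p617773). CONDITIONAL (the gate records `proof.conditional`): `hprim` is the open
kernel (W. Zhang's base case of Kolyvagin's conjecture read at `p = 2`, in its sharpest classical currency); on WALL row 1 its
supply half is discharged modulo Mazur–Rubin Cor. 3.4 (i) by `…AuxiliaryFieldRowOneOddTwist`. The lead's verdict on the item as
typed (bare `∀ K`: BSD-inconsistent at `DEF ≥ 3`) is unaffected; BSD is not proved by any of this.

References: [GrossLMS1991] §3–§5; [McCallumLMS1991] §5; [SilvermanAEC2009] X.2 Prop. 2.4, X.5 Cor. 5.4; [WZhang2014] Thm. 1.1.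
-/

set_option linter.dupNamespace false -- tree convention: `Summit.BirchSwinnertonDyer.BirchSwinnertonDyer.Theorems` (summit = sub-problem)

noncomputable section

open scoped Classical

namespace Summit.BirchSwinnertonDyer.BirchSwinnertonDyer.Theorems.GenusKoly

open Finset NumberField WeierstrassCurve Literature.NumberTheory.EllipticCurves
  Literature.NumberTheory.EllipticCurves.ModularForms
  Summit.BirchSwinnertonDyer.Rank1Residual.AdditivePotMult
  Summit.BirchSwinnertonDyer.Rank1Residual.X11b.RingClassConj
  Summit.BirchSwinnertonDyer.BirchSwinnertonDyer.Theses.GenusKolyvaginAtTwo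

/-- **U BY NAME from ODD-TWIST PRIMITIVITY.** `MultiGenusPrimitivityAtTwo` follows from the displayed hypothesis `hprim`: for
every instance of U's binders with `2 ∣ P(1)`, an odd-twist primitivity package at some Kolyvagin prime `ℓ` (datum, radicals,
enumeration, reduced genus point `W_ℓ`, `√d ∈ K ∖ ℚ` with a Sel₂-trivial elliptic model of `W^{(ℓ*·d)}`, `θ_ℓ ∉ ℚ`, and: every
rational `z₀ ∈ W^{(ℓ*)}(ℚ)` with `Φ(ι z₀)` an odd multiple of `W_ℓ` has no odd multiple in `2·W^{(ℓ*)}(ℚ)`). Proof: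
`heegner_auxPrimitive_iff_oddTwistPoint` turns the package into the auxiliary-field package of
`heegner_exists_multiGenusCertificate_of_auxFieldPrimitive_levelOne`; `M₀ = 0` is `stub_levelOne` (through
`multiGenusPrimitivityAtTwo_of_stubPositiveDepth`). CONDITIONAL on `hprim` (open).
[cite: GrossLMS1991, §3 (3.1)–(3.5), §4 (4.1), Lemma 4.3, §5] [cite: McCallumLMS1991, §5] [cite: WZhang2014, Thm. 1.1] -/
theorem multiGenusPrimitivityAtTwo_of_oddTwistPrimitive
    (hprim : ∀ (W : WeierstrassCurve ℚ) [W.IsElliptic] [W.IsGloballyMinimal] [NeZero (W.conductorNorm ℤ)], ¬ W.HasCM →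
      W.analyticRank = 0 → (∀ n : ℕ, 0 < n → W.HasSurjectiveModNGaloisRep ((2 : ℤ) ^ n)) → Odd W.tamagawaProduct →
      ∀ (K : Type) [Field K] [NumberField K], IsImaginaryQuadratic K →
      Odd (NumberField.discr K) → NumberField.discr K ≠ -3 → SatisfiesHeegnerHypothesis (W.conductorNorm ℤ) K →
      ¬ IsSquare ((NumberField.discr K : ℚ) * -|W.Δ|) → ¬ IsSquare ((NumberField.discr K : ℚ) * (-(2 * |W.Δ|))) →
      ∀ (Dt : ModularParametrizationData W (W.conductorNorm ℤ)),
      (∀ z ∈ Dt.L.lattice, ∃ w ∈ periodLattice Dt.f, z = (Dt.c : ℂ) * w) →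
      Odd Dt.c → ∀ (β : ℤ) (ι : K →+* ℂ) (d₁ : KolyvaginHeegnerData Dt β ι 1),
      ¬ IsOfFinAddOrder d₁.derivedPoint → ∀ (Wd : WeierstrassCurve ℚ) [Wd.IsElliptic] [Wd.IsGloballyMinimal],
      (∃ C : VariableChange ℚ, C • W.quadraticTwist (NumberField.discr K : ℚ) = Wd) → Wd.analyticRank = 1 →
      Nat.card (Wd.selmerGroup 2) = 2 →
      (∃ Q : (W.baseChange (ringClassField K ι 1)).toAffine.Point, (2 : ℤ) • Q = d₁.derivedPoint) →
      ∃ (ℓ : ℕ) (d : KolyvaginHeegnerData Dt β ι ℓ) (θ : ℕ → ringClassField K ι ℓ)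
        (G : Finset (ringClassField K ι ℓ ≃ₐ[ℚ] ringClassField K ι ℓ))
        (Wn : (W.baseChange (ringClassField K ι ℓ)).toAffine.Point)
        (s₀ : K) (dK : ℚ) (We : WeierstrassCurve ℚ) (_ : We.IsElliptic)
        (hθQ : θ ℓ ∉ Set.range (algebraMap ℚ (ringClassField K ι ℓ)))
        (hθℓ : θ ℓ ^ 2 = algebraMap ℚ (ringClassField K ι ℓ) ((-1 : ℚ) ^ (ℓ / 2) * ℓ)),
        ℓ.Prime ∧ (∀ ℓ' ∈ ℓ.primeFactors, Zhang2014.IsKolyvaginPrime (W.conductorNorm ℤ) W K 2 ℓ') ∧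
        (∀ ℓ' ∈ ℓ.primeFactors, θ ℓ' ^ 2 = algebraMap ℚ (ringClassField K ι ℓ) ((-1 : ℚ) ^ (ℓ' / 2) * ℓ')) ∧
        (∀ g, g ∈ G ↔ g ∈ ringClassGal ι ℓ) ∧
        s₀ ∉ Set.range (algebraMap ℚ K) ∧ s₀ ^ 2 = algebraMap ℚ K dK ∧
        (∃ C : VariableChange ℚ, C • W.quadraticTwist (((-1 : ℚ) ^ (ℓ / 2) * ℓ) * dK) = We) ∧
        Nat.card (We.selmerGroup 2) = 1 ∧
        ((2 : ℤ) ^ ℓ.primeFactors.card) • Wn =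
          ∑ g ∈ G, (∏ ℓ' ∈ ℓ.primeFactors, (if g (θ ℓ') = θ ℓ' then (1 : ℤ) else -1)) •
            pointGalHom W (ringClassField K ι ℓ) g d.y ∧
        ∀ (m₀ : ℕ) (z₀ : (W.quadraticTwist ((-1 : ℚ) ^ (ℓ / 2) * ℓ)).toAffine.Point), Odd m₀ →
          twistPointEquivOver W hθQ hθℓ
            (QuadraticDescent.incl (ringClassField K ι ℓ : Type) (W.quadraticTwist ((-1 : ℚ) ^ (ℓ / 2) * ℓ)) z₀) =
              (m₀ : ℤ) • Wn →
          ∀ m : ℕ, Odd m → ¬ ∃ z : (W.quadraticTwist ((-1 : ℚ) ^ (ℓ / 2) * ℓ)).toAffine.Point,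
            (2 : ℤ) • z = (m : ℤ) • z₀) :
    MultiGenusPrimitivityAtTwo := by
  refine MultiGenusPrimitivityAtTwo.multiGenusPrimitivityAtTwo_of_stubPositiveDepth ?_
  intro W _ _ _ hcm hr0 hρ hT K _ _ hIQ hodd h3 hHe hsq1 hsq2 Dt hopt hc β ι d₁ hy Wd _ _ hWd hrd hSel hM
  have hsurj : W.HasSurjectiveModNGaloisRep ((2 : ℤ) ^ 1) := hρ 1 one_pos
  obtain ⟨ℓ, d, θ, G, Wn, s₀, dK, We, hWe, hθQ, hθℓ, hℓ, hKoly, hθ, hG, hs₀, hs₀2, hC, hSelWe, hWn, hz⟩ :=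
    hprim W hcm hr0 hρ hT K hIQ hodd h3 hHe hsq1 hsq2 Dt hopt hc β ι d₁ hy Wd hWd hrd hSel hM
  haveI := hWe
  have htw : Finite (W.quadraticTwist (((-1 : ℚ) ^ (ℓ / 2) * ℓ) * dK)).toAffine.Point :=
    finite_point_of_card_selmerGroup_two_eq_one _ We hC hSelWe
  obtain ⟨⟨m₀, z₀, hm₀, hz₀⟩, hiff⟩ :=
    heegner_auxPrimitive_iff_oddTwistPoint hIQ hodd hHe hsurj hℓ hKoly d hθ hθQ hθℓ G hG hs₀ hs₀2 htw hWn
  exact heegner_exists_multiGenusCertificate_of_auxFieldPrimitive_levelOne hIQ hodd h3 hHe hsurj d₁ hM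
    ⟨ℓ, d, θ, G, Wn, s₀, dK, We, hWe, hℓ, hKoly, hθ, hG, hs₀, hs₀2, hC, hSelWe, hWn,
      (hiff m₀ z₀ hm₀ hz₀).mpr (hz m₀ z₀ hm₀ hz₀)⟩

end Summit.BirchSwinnertonDyer.BirchSwinnertonDyer.Theorems.GenusKoly

end
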